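import Summits.BirchSwinnertonDyer.BirchSwinnertonDyer.Theorems.ByReductionTypeAtTwoMultUpperHalfTowerAcur2L
import Summits.BirchSwinnertonDyer.BirchSwinnertonDyer.Theorems.ByReductionTypeAtTwoMultTowerAcurClass3718h
import Summits.BirchSwinnertonDyer.BirchSwinnertonDyer.Theorems.ByReductionTypeAtTwoMultKatoNonsplitDescent
import HarnessLib

/-!
# MULT TOWER-road CLASS INSTANCE in the A-CURRENCY, TWO-LAYER form — rows file L: `3718h1`
# (route ByReductionTypeAtTwo, item `MultUpperHalfAtTwo` stmt-BirchSwinnertonDyer-19922; seat bsd-2adic-tower-1 GEN 16, generator `tower/gen16/rowsL.py`)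

Cell `bsd-2adic` (run/shared/lean/pub/bsd-2adic/). The class `3718h` (member `3718h1`, `N = 3718 = 2 · 11 · 13²`, NON-SPLIT at `2`, `u·c ≡ 7 (8)`, `λ_an = 7`)
has the A-currency class file `…MultTowerAcurClass3718h.lean` (tower-1 GEN 13 demo p573346: σ-window theorems `…_A3`) and the descent-keyed add-on
`MultTowerAddOn.bsdp_two_3718h1_A3_of_descent` (`…MultTowerAddOnACUR01`, GEN 15), but NO two-layer theorem: GEN 15's rows files A–K (`tower/gen15/a2lrows.py`)
took the CERT-NEW classes only and `3718h` was CERT-ALT in `tower/TABLE-MULT-TOWER-ACUR-HYBRID-gen14.tsv` (its σ-window file of another road landed first).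
It HAS a two-layer certificate — `(j, j') = (0, 3)`: `a = d_0 = 2` (classical `d_0..3 = 2/3/5/7`), `d = ehi₃ = 7` (induced count, TWO-ENGINE: ENGINE A3σ kit j292091 ∥
ENGINE B2 v4.1 kit j292498, `tower/TABLE-MULT-TOWER-A3SIGMA-pilot69-eng2.tsv` @c26c16bbc469f855; = ENGINE A of record `eindhi₃`; GRH strike ENGINE G cert `J = 3` kit j292582),
`d + 1 = 8 ≤ 2^3 − 2^0 + a = 9` (slack 1) — so this file adds, exactly as rows A–K + the RC-188 add-on keying:
* `towerGapAtTwo_3718h1_A2L` — σ-free two-layer gap (door `MultTowerAcur.towerGapAtTwo_of_twoLayer_classCounts_upper_of_irr`, p581424; window-generic `j ≤ j'`);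
* `bsdp_two_3718h1_A2L_of_descent` — the desk display BORN DESCENT-KEYED (located inputs {`hne`, `h12`, `hdesc`, `h15`}, door
  `MultKatoRat.missingUpperBoundAt_two_nonsplit_of_towerGapMember_of_descent`) + PRINT {`h41ns'`, `h41sp`, `hmod`, `hGZK`, `hCassels`, `hC`} + CERT {`hr`, `hjj'`, `hlow` (= `d_j`, NO σ-vector), `hup`, `had`, `hsha`}.
HONEST FRAMING (HUMAN RULINGS D-0036 / D-0054 / D-0074): class-display theorems only — no definition, no new named fact, no `sorry`; no class closes here,
nothing is booked; the counts are instrument output (evidence tier); BSD is not proved by any of this.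
References: [GreenbergLNM1716] §1 p. 60, §3 pp. 85–94, §4 pp. 112–113; [Kato2004Asterisque] Thm. 17.4; [Cesnavicius2018] Thm. 1.2; [Miller2011LMS] Def. 1.1; [Washington1997] §13.2.
-/

set_option autoImplicit false
-- the Theorems namespace of this sub repeats the summit name by design (D-0017 nested layout: Summit.<S>.<Sub>)
set_option linter.dupNamespace false

noncomputable section

open scoped Classical MatrixGroups ModularForm

open NumberField IsDedekindDomain CongruenceSubgroup WeierstrassCurve Literature.NumberTheory.EllipticCurves
  Literature.NumberTheory.EllipticCurves.ModularForms Literature.NumberTheory.EllipticCurves.Rank1Residual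
  Literature.NumberTheory.EllipticCurves.Rank1Residual.Typed
  Literature.NumberTheory.EllipticCurves.Rank1Residual.X11RankOneCertificates
  Literature.NumberTheory.EllipticCurves.Greenberg1999
  Summit.BirchSwinnertonDyer.Rank1Residual.X5 Summit.BirchSwinnertonDyer.Rank1Residual.X5.O1
  Summit.BirchSwinnertonDyer.Rank1Residual.X5.Instances
  Summit.BirchSwinnertonDyer.BirchSwinnertonDyer.Theorems.KatoHalfPinch
  Summit.BirchSwinnertonDyer.BirchSwinnertonDyer.Theorems.Rank1ResidualX1Defs

namespace Summit.BirchSwinnertonDyer.BirchSwinnertonDyer.Theorems.MultTowerAcurClass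

/-- **Two-layer A-currency tower gap for `3718h1`** (any `j ≤ j'`; HYBRID counts: `hlow : 2^a ≤ #Sel_{2^∞}(E/ℚ_j)[2]` — the PLAIN classical layer count, NO σ-vector —,
`hup : #A_{j'}[2] ≤ 2^d` — the induced layer count —, `had : d + 1 ≤ 2^{j'} − 2^j + a`). [cite: GreenbergLNM1716, §1 p. 60 and §3 pp. 85–86] [cite: Washington1997, §13.2] -/
theorem towerGapAtTwo_3718h1_A2L
    {j j' a d : ℕ} (hjj' : j ≤ j')
    (hlow : ∀ κ : ZpExtension ℚ 2, κ.IsCyclotomic → 2 ^ a ≤ Nat.card {z : c3718h1.selmerLayer κ j // 2 • z = 0})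
    (hup : ∀ κ : ZpExtension ℚ 2, κ.IsCyclotomic → Nat.card {z : c3718h1.selmerInftyPreimage κ j' // 2 • z = 0} ≤ 2 ^ d)
    (had : d + 1 ≤ 2 ^ j' - 2 ^ j + a) : TowerGapAtTwo c3718h1 :=
  MultTowerAcur.towerGapAtTwo_of_twoLayer_classCounts_upper_of_irr c3718h1 irr_two_3718h1 hjj' hlow hup had

/-- **DESK DISPLAY `BSD(3718h1, 2)`, BORN DESCENT-KEYED, TWO-LAYER form** (σ-free lower leg): located inputs {`hne`, `h12`, `hdesc`, `h15`},
gap = `towerGapAtTwo_3718h1_A2L`; display = PRINT {h41ns', h41sp, hmod, hGZK, hCassels, hC} + `hdesc` + `hr` + CERT {hjj', hlow (= d_j), hup, had} + `hsha`.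
Not a booking. [cite: Kato2004Asterisque, Thm. 17.4] [cite: Miller2011LMS, Def. 1.1] -/
theorem bsdp_two_3718h1_A2L_of_descent
    (hne : Kato2004.nonempty_iwasawaH1Data) (h12 : Kato2004.thm12_4)
    (hdesc : Kato2004.exists_multDivisibilityInputsDescent_nonsplit)
    (h15 : thm15_isTorsion_multiplicative_rat)
    (h41ns' : thm41Analogue_charValue_rankZero_numberField_anyPrime_oddLocalDegree)
    (h41sp : thm41Analogue_charValue_rankZero_split_baseChange_anyPrime)
    (hmod : nonempty_modularParametrizationData) (hGZK : rank_eq_analyticRank_of_analyticRank_le_one)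
    (hCassels : bsdRHS_eq_of_isIsogenous) (hC : cesnavicius_not_two_dvd_maninConstant_of_two_dvd_level)
    (hr : c3718h1.analyticRank = 0)
    {j j' a d : ℕ} (hjj' : j ≤ j')
    (hlow : ∀ κ : ZpExtension ℚ 2, κ.IsCyclotomic → 2 ^ a ≤ Nat.card {z : c3718h1.selmerLayer κ j // 2 • z = 0})
    (hup : ∀ κ : ZpExtension ℚ 2, κ.IsCyclotomic → Nat.card {z : c3718h1.selmerInftyPreimage κ j' // 2 • z = 0} ≤ 2 ^ d)
    (had : d + 1 ≤ 2 ^ j' - 2 ^ j + a) (hsha : MissingLowerBoundAt c3718h1 2) : BSDp c3718h1 2 :=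
  bsdp_of_missingPPartAt _ 2 hGZK (hr.le.trans zero_le_one) (missingPPartAt_of_lower_of_upper _ 2 hsha
    (MultKatoRat.missingUpperBoundAt_two_nonsplit_of_towerGapMember_of_descent hne h12 hdesc h15 h41ns' h41sp hmod hGZK hCassels
      hC _ hr mult_two_3718h1 _ (IsIsogenous.refl_holds _) nonsplit_two_3718h1
      (towerGapAtTwo_3718h1_A2L hjj' hlow hup had) (Or.inl irr_two_3718h1)))

end Summit.BirchSwinnertonDyer.BirchSwinnertonDyer.Theorems.MultTowerAcurClass

end
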